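import Summits.KontsevichZagierPeriods.KontsevichZagierPeriods.Theses.VeryGoodTransfer
import Literature.NumberTheory.Transcendental.KZRelationsLE
import Literature.NumberTheory.Transcendental.KZLogCalculusProofs

/-!
# `AlgebraicScalingActsOnRelations` (stmt-KontsevichZagierPeriods-5092, route VeryGoodTransfer) — proof

The `k_ℝ`-module structure of `P_KZ`: for every real algebraic number `a` there is an additive
endomorphism `s_a` of the free abelian group `KZ.FormalRep` on integral representations which
(i) maps `KZ.relations` into itself and (ii) sends each generator `[σ, f]` to a representation of
`[σ, a·f]` modulo relations.

Proof: the tree already carries the scaling endomorphism `KZ.scale a ha` (`KZRelationsLE.lean`),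
defined on generators by `[σ, f] ↦ [σ, a·f]` (`KZ.IntegralRep.constMul`, `KZ.scale_of`); it maps every
move set, hence `KZ.relations`, into itself (`KZ.scale_mem_relations`, no hypothesis `a ≠ 0`), and
for any `r'` with the same domain as `r` and integrand `a·f` on it, `s_a [r] − [r'] = [r.constMul a] − [r']`
is a relation because the two representations have equal domains and integrands agreeing on them
(`KZ.of_sub_of_mem_relations_of_eqOn`, one integrand-additivity move with a zero representation).
-/

noncomputable section

open Set
open Literature.NumberTheory.Transcendental

namespace Summit.KontsevichZagierPeriods.VeryGoodTransfer

/-- **`AlgebraicScalingActsOnRelations`** (route VeryGoodTransfer, stmt-KontsevichZagierPeriods-5092):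
for every real algebraic `a` there is an additive endomorphism `s` of `KZ.FormalRep` preserving
`KZ.relations` with `s [r] − [r'] ∈ KZ.relations` whenever `r'` has the domain of `r` and integrand
`a · r.integrand` on it. Witness: `s = KZ.scale a ha`; relation-preservation is
`KZ.scale_mem_relations`, and `KZ.scale_of` with `KZ.of_sub_of_mem_relations_of_eqOn` gives the second
clause. [cite: KontsevichZagier2001, §1.2] -/
theorem algebraicScalingActsOnRelations_proof :
    Summit.KontsevichZagierPeriods.KontsevichZagierPeriods.Theses.VeryGoodTransfer.AlgebraicScalingActsOnRelations := by
  intro a ha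
  refine ⟨KZ.scale a ha, fun c hc => KZ.scale_mem_relations a ha hc, fun n r r' hd hi => ?_⟩
  rw [KZ.scale_of]
  refine KZ.of_sub_of_mem_relations_of_eqOn (by rw [hd, KZ.IntegralRep.domain_constMul])
    fun x hx => ?_
  rw [KZ.IntegralRep.integrand_constMul]
  exact (hi hx).symm

end Summit.KontsevichZagierPeriods.VeryGoodTransfer

end
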